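import Mathlib
import Literature.Barriers.PneNP.ExtendedFormulationMinkowskiFaces
import Literature.Barriers.PneNP.ExtendedFormulationLinearImage
import Literature.Barriers.PneNP.CorrelationPolytopeXCLowerBoundGraph
import Summits.ValiantsHypothesis.ValiantsHypothesis.Theorems.FifoMatchingXcDivisionZmixFace
import HarnessLib

/-!
# The LOCATED-FACE EXPOSURE RUNG (stub E of line `virtual_passenger`, crux `NNDivisionHard`, stmt-ValiantsHypothesis-21181)

Theorems-side port (`--supports stmt-ValiantsHypothesis-21181`, helper; director-valiant g16 KEY b135 / desk #325; port hand
val-np-p6 g16) of §2d of the line of record `Cruxes/NNDivisionHard/Lines/virtual_passenger.lean` rev 3 (pen val-idea-42 g0, who PROVED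
it there; statement = val-idea-38 g0's `LocatedFaceExposureRung`, `PairFace.lean` rev 4, verified on paper by the critic of record
val-idea-crit-9 g0, 2026-08-28).  The statement below is that `def … : Prop` δ-UNFOLDED (its `BlockConstSymGen β g` =
«`g` symmetric and `β`-block-constant», `Jdir n = fun _ => 1`), so the line closes its copy by `exact`.  Definition-free: the block
direction `C₀^β` enters only through its dot products (`exists_blockDir`), the span `W_β` of the block-constant vertices and the
representative read `x ↦ (x (ρ i, ρ j))` are spelled out.

MECHANISM (val-idea-42 / val-idea-38 / crit-9 ADVISORY #2).  The block direction `C₀^β = Σ_{p ≠ q, β p = β q} (e_{pq} − e_{pp})` is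
valid on `COR(K_n)` with maximum `0`, tight exactly at the `β`-block-constant vertices (termwise: `[b p][b q] − [b p] ≤ 0`, `= 0` iff
`b p → b q`); every functional vanishing on `W_β = span{corVec b : b block-constant}` is constant (`= 0`) on that contraction face, so
faces of `(COR ∩ face) + conv q` in such directions cut only the passenger, and each cut kills a pair of generators whose difference is
not in `W_β` (`blockRead_iterate`, induction on the number of generators).  At the end all surviving differences lie in
`W_β ⊆ lin F_β` (symmetric, block-constant), hence — the rung's hypothesis — are multiples of `J`: the surviving passenger is collinear,
its hull is a SEGMENT (`convexHull_collinear_pair`), and the representative read maps the contraction face onto `COR(K_m)`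
(`funLeft_image_cor_blockFace`).  Faces and linear images of extended formulations: `HasEFOfSize.face_add_face₁`,
`HasEFOfSize.image_linearMap` (Literature, val-lit-p10).

HONEST LABEL: a helper row for an OPEN crux (21181 `NNDivisionHard` OPEN; COR-VIRTUAL OPEN); nothing here is a summit statement;
VP ≠ VNP is NOT proved.
-/

set_option autoImplicit false
-- the mandated summit-side namespace repeats a component by design (single-problem summit)
set_option linter.dupNamespace false

noncomputable section
open Matrix Finset
open scoped Pointwise

namespace Summit.ValiantsHypothesis.ValiantsHypothesis.Theorems.FifoMatching

namespace LocatedFaceExposure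

open Literature.Barriers.PneNP (HasEFOfSize)
open Literature.Combinatorics.Optimization (corPolytopeGraph corVec)
open Summit.ValiantsHypothesis.ValiantsHypothesis.Theorems.FifoMatching.XcDivision
  (dot_le_of_mem_convexHull convexHull_range_inter_eq corVec_top_apply)

variable {n m : ℕ}

/-! ## The block direction `C₀^β`, through its dot products -/

/-- **The block direction exists**: a functional whose dot product with `x` is
`Σ_p Σ_q [β q = β p, q ≠ p] (x (p,q) − x (p,p))` (val-idea-38's `C₀^β`, val-idea-42's `bdir β`). -/
theorem exists_blockDir (β : Fin n → Fin m) :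
    ∃ B : Fin n × Fin n → ℝ, ∀ x : Fin n × Fin n → ℝ,
      B ⬝ᵥ x = ∑ p : Fin n, ∑ q : Fin n, if β q = β p ∧ q ≠ p then x (p, q) - x (p, p) else 0 := by
  classical
  refine ⟨∑ p : Fin n, ∑ q : Fin n,
    if β q = β p ∧ q ≠ p then (Pi.single (p, q) 1 - Pi.single (p, p) 1 : Fin n × Fin n → ℝ) else 0, fun x => ?_⟩
  rw [sum_dotProduct]
  refine Finset.sum_congr rfl fun p _ => ?_
  rw [sum_dotProduct]
  refine Finset.sum_congr rfl fun q _ => ?_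
  split_ifs
  · simp [sub_dotProduct]
  · exact zero_dotProduct x

/-- the pair term on a vertex: `[b p][b q] − [b p] ≤ 0`, … -/
theorem term_le (b : Fin n → Bool) (p q : Fin n) :
    corVec (⊤ : SimpleGraph (Fin n)) b (p, q) - corVec (⊤ : SimpleGraph (Fin n)) b (p, p) ≤ 0 := by
  rw [corVec_top_apply, corVec_top_apply]
  cases b p <;> cases b q <;> simp

/-- … and `= 0` iff `b p → b q`. -/
theorem term_eq_zero_iff (b : Fin n → Bool) (p q : Fin n) :
    corVec (⊤ : SimpleGraph (Fin n)) b (p, q) - corVec (⊤ : SimpleGraph (Fin n)) b (p, p) = 0 ↔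
      (b p = true → b q = true) := by
  rw [corVec_top_apply, corVec_top_apply]
  cases b p <;> cases b q <;> simp

section BlockDir

variable (β : Fin n → Fin m) {B : Fin n × Fin n → ℝ}
  (hB : ∀ x : Fin n × Fin n → ℝ,
    B ⬝ᵥ x = ∑ p : Fin n, ∑ q : Fin n, if β q = β p ∧ q ≠ p then x (p, q) - x (p, p) else 0)
include hB

/-- G1 (validity): `C₀^β ≤ 0` on the vertices of `COR(K_n)`. -/
theorem blockDir_dot_corVec_le (b : Fin n → Bool) : B ⬝ᵥ corVec (⊤ : SimpleGraph (Fin n)) b ≤ 0 := by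
  rw [hB]
  refine Finset.sum_nonpos fun p _ => Finset.sum_nonpos fun q _ => ?_
  split_ifs
  · exact term_le b p q
  · exact le_rfl

/-- G1 (validity on the polytope). -/
theorem blockDir_valid : ∀ x ∈ corPolytopeGraph (⊤ : SimpleGraph (Fin n)), B ⬝ᵥ x ≤ 0 :=
  dot_le_of_mem_convexHull _ _ _ (by rintro _ ⟨b, rfl⟩; exact blockDir_dot_corVec_le β hB b)

/-- G1 (tightness ⇒ block-constant). -/
theorem blockConst_of_dot_eq_zero {b : Fin n → Bool} (h : B ⬝ᵥ corVec (⊤ : SimpleGraph (Fin n)) b = 0) :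
    ∀ p q, β p = β q → b p = b q := by
  rw [hB] at h
  have hterm : ∀ p q : Fin n, β q = β p → q ≠ p → (b p = true → b q = true) := by
    intro p q hpq hne
    have hp := (Finset.sum_eq_zero_iff_of_nonpos fun p' _ =>
      Finset.sum_nonpos fun q' _ => by
        split_ifs
        · exact term_le b p' q'
        · exact le_rfl).1 h p (Finset.mem_univ _)
    have hq := (Finset.sum_eq_zero_iff_of_nonpos fun q' _ => by
        split_ifs
        · exact term_le b p q'
        · exact le_rfl).1 hp q (Finset.mem_univ _)
    rw [if_pos ⟨hpq, hne⟩] at hq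
    exact (term_eq_zero_iff b p q).1 hq
  intro p q hpq
  by_cases hne : p = q
  · rw [hne]
  have h1 := hterm p q hpq.symm (Ne.symm hne)
  have h2 := hterm q p hpq hne
  cases hbp : b p <;> cases hbq : b q <;> simp_all

/-- G1 (block-constant ⇒ tight). -/
theorem dot_eq_zero_of_blockConst {b : Fin n → Bool} (hb : ∀ p q, β p = β q → b p = b q) :
    B ⬝ᵥ corVec (⊤ : SimpleGraph (Fin n)) b = 0 := by
  rw [hB]
  refine Finset.sum_eq_zero fun p _ => Finset.sum_eq_zero fun q _ => ?_
  split_ifs with hc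
  · rw [corVec_top_apply, corVec_top_apply, hb p q hc.1.symm]
    cases b q <;> simp
  · rfl

/-- every functional vanishing on `W_β` (the span of the block-constant vertices) vanishes on the contraction face. -/
theorem dot_eq_zero_on_face {φ : Fin n × Fin n → ℝ}
    (hW : ∀ w ∈ Submodule.span ℝ (Set.range fun b : {b : Fin n → Bool // ∀ p q, β p = β q → b p = b q} =>
      corVec (⊤ : SimpleGraph (Fin n)) b.1), φ ⬝ᵥ w = 0) :
    ∀ x ∈ corPolytopeGraph (⊤ : SimpleGraph (Fin n)) ∩ {x | B ⬝ᵥ x = 0}, φ ⬝ᵥ x = 0 := by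
  intro x hx
  have hx' : x ∈ convexHull ℝ (Set.range fun b : {b : Fin n → Bool //
      B ⬝ᵥ corVec (⊤ : SimpleGraph (Fin n)) b = 0} => corVec (⊤ : SimpleGraph (Fin n)) b.1) := by
    have hx2 := hx
    unfold corPolytopeGraph at hx2
    rwa [convexHull_range_inter_eq _ B 0 (blockDir_dot_corVec_le β hB)] at hx2
  have hgen : ∀ y ∈ Set.range (fun b : {b : Fin n → Bool //
      B ⬝ᵥ corVec (⊤ : SimpleGraph (Fin n)) b = 0} => corVec (⊤ : SimpleGraph (Fin n)) b.1), φ ⬝ᵥ y = 0 := by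
    rintro _ ⟨b, rfl⟩
    apply hW
    exact Submodule.subset_span ⟨⟨b.1, blockConst_of_dot_eq_zero β hB b.2⟩, rfl⟩
  have h1 := dot_le_of_mem_convexHull _ φ 0 (fun y hy => (hgen y hy).le) x hx'
  have h2 := dot_le_of_mem_convexHull _ (-φ) 0 (fun y hy => by rw [neg_dotProduct, hgen y hy, neg_zero]) x hx'
  rw [neg_dotProduct] at h2
  linarith

/-- **The iterated-face engine, block version** (val-idea-42): faces in directions vanishing on `W_β` leave the contraction face
untouched and kill one bad pair of generators at a time; at the end all differences of surviving generators lie in `W_β`. -/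
theorem blockRead_iterate {J : Type} (q : J → (Fin n × Fin n → ℝ)) (r : ℕ) :
    ∀ (N : ℕ) (Jk : Finset J), Jk.card ≤ N → Jk.Nonempty →
      HasEFOfSize (corPolytopeGraph (⊤ : SimpleGraph (Fin n)) ∩ {x | B ⬝ᵥ x = 0} +
        convexHull ℝ (q '' (Jk : Set J))) r →
      ∃ J' : Finset J, J' ⊆ Jk ∧ J'.Nonempty ∧
        (∀ j ∈ J', ∀ j' ∈ J', q j - q j' ∈
          Submodule.span ℝ (Set.range fun b : {b : Fin n → Bool // ∀ p q, β p = β q → b p = b q} =>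
            corVec (⊤ : SimpleGraph (Fin n)) b.1)) ∧
        HasEFOfSize (corPolytopeGraph (⊤ : SimpleGraph (Fin n)) ∩ {x | B ⬝ᵥ x = 0} +
          convexHull ℝ (q '' (J' : Set J))) r := by
  classical
  intro N
  induction N with
  | zero =>
    intro Jk hcard hne _
    have := Finset.card_pos.2 hne
    omega
  | succ N ih =>
    intro Jk hcard hne hEF
    by_cases hall : ∀ j ∈ Jk, ∀ j' ∈ Jk, q j - q j' ∈
        Submodule.span ℝ (Set.range fun b : {b : Fin n → Bool // ∀ p q, β p = β q → b p = b q} =>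
          corVec (⊤ : SimpleGraph (Fin n)) b.1)
    · exact ⟨Jk, Finset.Subset.refl _, hne, hall, hEF⟩
    push Not at hall
    obtain ⟨j, hj, j', hj', hd⟩ := hall
    obtain ⟨f, hf, hfW⟩ := Submodule.exists_dual_map_eq_bot_of_notMem hd inferInstance
    obtain ⟨φ, hφdef⟩ : ∃ φ : Fin n × Fin n → ℝ, φ = fun i => f (Pi.single i 1) := ⟨_, rfl⟩
    have hφ : ∀ v, φ ⬝ᵥ v = f v := by
      intro v
      conv_rhs => rw [pi_eq_sum_univ' v, map_sum]
      simp only [dotProduct, map_smul, smul_eq_mul, hφdef]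
      exact Finset.sum_congr rfl fun i _ => mul_comm _ _
    have hW : ∀ w ∈ Submodule.span ℝ (Set.range fun b : {b : Fin n → Bool // ∀ p q, β p = β q → b p = b q} =>
        corVec (⊤ : SimpleGraph (Fin n)) b.1), φ ⬝ᵥ w = 0 := by
      intro w hw
      rw [hφ]
      have hmem : f w ∈ (Submodule.span ℝ (Set.range fun b : {b : Fin n → Bool // ∀ p q, β p = β q → b p = b q} =>
        corVec (⊤ : SimpleGraph (Fin n)) b.1)).map f := Submodule.mem_map_of_mem hw
      rw [hfW, Submodule.mem_bot] at hmem
      exact hmem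
    have hCF0 := dot_eq_zero_on_face β hB hW
    obtain ⟨j₀, hj₀, hmax⟩ := Finset.exists_max_image Jk (fun i => φ ⬝ᵥ q i) hne
    have hQ : ∀ y ∈ convexHull ℝ (q '' (Jk : Set J)), φ ⬝ᵥ y ≤ φ ⬝ᵥ q j₀ :=
      dot_le_of_mem_convexHull _ φ _ (by rintro _ ⟨i, hi, rfl⟩; exact hmax i hi)
    have hface := hEF.face_add_face₁ φ 0 (φ ⬝ᵥ q j₀) (fun x hx => (hCF0 x hx).le) hQ
    have hCFeq : (corPolytopeGraph (⊤ : SimpleGraph (Fin n)) ∩ {x | B ⬝ᵥ x = 0}) ∩ {x | φ ⬝ᵥ x = 0} =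
        corPolytopeGraph (⊤ : SimpleGraph (Fin n)) ∩ {x | B ⬝ᵥ x = 0} :=
      Set.inter_eq_left.2 fun x hx => hCF0 x hx
    have hQeq : convexHull ℝ (q '' (Jk : Set J)) ∩ {y | φ ⬝ᵥ y = φ ⬝ᵥ q j₀} =
        convexHull ℝ (q '' ((Jk.filter fun i => φ ⬝ᵥ q i = φ ⬝ᵥ q j₀ : Finset J) : Set J)) := by
      rw [Set.image_eq_range q (Jk : Set J),
        convexHull_range_inter_eq (fun x : (Jk : Set J) => q x) φ (φ ⬝ᵥ q j₀)
          (fun i => hmax i.1 (Finset.mem_coe.1 i.2))]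
      congr 1
      ext y
      constructor
      · rintro ⟨⟨⟨i, hi⟩, hφi⟩, rfl⟩
        exact ⟨i, Finset.mem_coe.2 (Finset.mem_filter.2 ⟨hi, hφi⟩), rfl⟩
      · rintro ⟨i, hi, rfl⟩
        exact ⟨⟨⟨i, (Finset.mem_filter.1 (Finset.mem_coe.1 hi)).1⟩,
          (Finset.mem_filter.1 (Finset.mem_coe.1 hi)).2⟩, rfl⟩
    rw [hCFeq, hQeq] at hface
    have hsub : (Jk.filter fun i => φ ⬝ᵥ q i = φ ⬝ᵥ q j₀) ⊆ Jk := Finset.filter_subset _ _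
    have hne' : (Jk.filter fun i => φ ⬝ᵥ q i = φ ⬝ᵥ q j₀).Nonempty := ⟨j₀, Finset.mem_filter.2 ⟨hj₀, rfl⟩⟩
    have hlt : (Jk.filter fun i => φ ⬝ᵥ q i = φ ⬝ᵥ q j₀).card < Jk.card := by
      apply Finset.card_lt_card
      refine Finset.ssubset_iff_subset_ne.2 ⟨hsub, fun heq => ?_⟩
      have e1 := (Finset.mem_filter.1 (heq ▸ hj)).2
      have e2 := (Finset.mem_filter.1 (heq ▸ hj')).2
      apply hf
      rw [← hφ, dotProduct_sub, e1, e2, sub_self]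
    obtain ⟨J', hJ', hneJ', hallJ', hEFJ'⟩ := ih _ (by omega) hne' hface
    exact ⟨J', hJ'.trans hsub, hneJ', hallJ', hEFJ'⟩

/-- G2: **the contraction face read by representatives IS `COR(K_m)`** (`ρ` a section of `β`; the read is
`x ↦ (x (ρ i, ρ j))_{i j}`). -/
theorem funLeft_image_cor_blockFace {ρ : Fin m → Fin n} (hρ : ∀ t, β (ρ t) = t) :
    LinearMap.funLeft ℝ ℝ (fun ij : Fin m × Fin m => (ρ ij.1, ρ ij.2)) ''
        (corPolytopeGraph (⊤ : SimpleGraph (Fin n)) ∩ {x | B ⬝ᵥ x = 0}) =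
      corPolytopeGraph (⊤ : SimpleGraph (Fin m)) := by
  have hread : ∀ b : Fin n → Bool,
      LinearMap.funLeft ℝ ℝ (fun ij : Fin m × Fin m => (ρ ij.1, ρ ij.2)) (corVec (⊤ : SimpleGraph (Fin n)) b) =
        corVec (⊤ : SimpleGraph (Fin m)) (b ∘ ρ) := by
    intro b
    funext ij
    obtain ⟨i, j⟩ := ij
    rw [LinearMap.funLeft_apply, corVec_top_apply, corVec_top_apply]
    rfl
  unfold corPolytopeGraph
  rw [convexHull_range_inter_eq _ B 0 (blockDir_dot_corVec_le β hB), LinearMap.image_convexHull, ← Set.range_comp]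
  congr 1
  ext y
  constructor
  · rintro ⟨⟨b, hb⟩, rfl⟩
    exact ⟨b ∘ ρ, (hread b).symm⟩
  · rintro ⟨a, rfl⟩
    refine ⟨⟨a ∘ β, dot_eq_zero_of_blockConst β hB fun p q hpq => by simp [Function.comp, hpq]⟩, ?_⟩
    show LinearMap.funLeft ℝ ℝ (fun ij : Fin m × Fin m => (ρ ij.1, ρ ij.2)) (corVec ⊤ (a ∘ β)) = corVec ⊤ a
    rw [hread]
    congr 1
    funext t
    simp [Function.comp, hρ t]

end BlockDir

/-- `W_β ⊆ lin F_β`: every element of the span of the block-constant vertices is symmetric and `β`-block-constant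
(val-idea-38's `BlockConstSymGen`, unfolded). -/
theorem blockConstSym_of_mem_span (β : Fin n → Fin m) {d : Fin n × Fin n → ℝ}
    (hd : d ∈ Submodule.span ℝ (Set.range fun b : {b : Fin n → Bool // ∀ p q, β p = β q → b p = b q} =>
      corVec (⊤ : SimpleGraph (Fin n)) b.1)) :
    (∀ p q, d (p, q) = d (q, p)) ∧ ∀ p q p' q', β p = β p' → β q = β q' → d (p, q) = d (p', q') := by
  refine Submodule.span_induction
    (p := fun d _ => (∀ p q, d (p, q) = d (q, p)) ∧ ∀ p q p' q', β p = β p' → β q = β q' → d (p, q) = d (p', q'))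
    ?_ ?_ ?_ ?_ hd
  · rintro _ ⟨⟨b, hb⟩, rfl⟩
    refine ⟨fun p q => ?_, fun p q p' q' hp hq => ?_⟩
    · show corVec ⊤ b (p, q) = corVec ⊤ b (q, p)
      rw [corVec_top_apply, corVec_top_apply, mul_comm]
    · show corVec ⊤ b (p, q) = corVec ⊤ b (p', q')
      rw [corVec_top_apply, corVec_top_apply, hb p p' hp, hb q q' hq]
  · exact ⟨fun _ _ => rfl, fun _ _ _ _ _ _ => rfl⟩
  · rintro x y - - ⟨hx1, hx2⟩ ⟨hy1, hy2⟩
    refine ⟨fun p q => ?_, fun p q p' q' hp hq => ?_⟩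
    · simp only [Pi.add_apply, hx1 p q, hy1 p q]
    · simp only [Pi.add_apply, hx2 p q p' q' hp hq, hy2 p q p' q' hp hq]
  · rintro a x - ⟨hx1, hx2⟩
    refine ⟨fun p q => ?_, fun p q p' q' hp hq => ?_⟩
    · simp only [Pi.smul_apply, hx1 p q]
    · simp only [Pi.smul_apply, hx2 p q p' q' hp hq]

/-- points on a line through `x₀` in direction `Jd`, finitely many: their hull is the hull of two of them. [folklore] -/
theorem convexHull_collinear_pair {V : Type*} [AddCommGroup V] [Module ℝ V] {J : Type} (q : J → V) (Jd : V)
    (S : Finset J) (hS : S.Nonempty) (α : J → ℝ) (x₀ : V) (hq : ∀ j ∈ S, q j = x₀ + α j • Jd) :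
    ∃ a ∈ S, ∃ b ∈ S, convexHull ℝ (q '' (S : Set J)) = convexHull ℝ {q a, q b} := by
  classical
  obtain ⟨a, ha, hamin⟩ := Finset.exists_min_image S α hS
  obtain ⟨b, hb, hbmax⟩ := Finset.exists_max_image S α hS
  refine ⟨a, ha, b, hb, Set.Subset.antisymm ?_ ?_⟩
  · refine convexHull_min ?_ (convex_convexHull ℝ _)
    rintro _ ⟨j, hj, rfl⟩
    rw [convexHull_pair]
    have hja := hamin j hj
    have hjb := hbmax j hj
    by_cases hab : α a = α b
    · have : q j = q a := by
        rw [hq j hj, hq a ha]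
        congr 1
        have : α j = α a := le_antisymm (hab ▸ hjb) hja
        rw [this]
      rw [this]
      exact left_mem_segment ℝ _ _
    · have hlt : α a < α b := lt_of_le_of_ne (le_trans hja hjb) hab
      rw [segment_eq_image']
      refine ⟨(α j - α a) / (α b - α a), ⟨div_nonneg (by linarith) (by linarith),
        (div_le_one (by linarith)).2 (by linarith)⟩, ?_⟩
      simp only
      rw [hq j hj, hq a ha, hq b hb, add_sub_add_left_eq_sub, ← sub_smul, smul_smul,
        div_mul_cancel₀ _ (sub_ne_zero.2 (Ne.symm hab)), add_assoc, ← add_smul, add_sub_cancel]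
  · refine convexHull_mono ?_
    intro y hy
    rcases hy with rfl | rfl
    · exact ⟨a, Finset.mem_coe.2 ha, rfl⟩
    · exact ⟨b, Finset.mem_coe.2 hb, rfl⟩

open Classical in
/-- ★★ **THE LOCATED-FACE EXPOSURE RUNG** (val-idea-38's `LocatedFaceExposureRung`, δ-unfolded; proof val-idea-42, line
`virtual_passenger` rev 3 §2d): if `ρ` is a section of the block map `β : [n] → [m]` and every SYMMETRIC `β`-BLOCK-CONSTANT difference
of generating points of the passenger is a multiple of the all-ones matrix `J`, then an extended formulation of
`COR(K_n) + conv{q j}` of size `r` yields one, of size `r`, of `COR(K_m) + conv{q' 0, q' 1}` for some two points `q'` (a segment or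
a point).  With PROP A at `K = 2` this gives `1.5^m ≤ 2 (r + 1)` (the line's class E). -/
theorem locatedFaceExposureRung_holds :
    ∀ (n m : ℕ) (β : Fin n → Fin m) (ρ : Fin m → Fin n), (∀ t, β (ρ t) = t) →
      ∀ (K : ℕ) (q : Fin (K + 1) → (Fin n × Fin n → ℝ)) (r : ℕ),
        (∀ j j', ((∀ p p', (q j - q j') (p, p') = (q j - q j') (p', p)) ∧
            ∀ p p' p'' p''', β p = β p'' → β p' = β p''' → (q j - q j') (p, p') = (q j - q j') (p'', p''')) →
          ∃ α : ℝ, q j - q j' = α • (fun _ : Fin n × Fin n => (1 : ℝ))) →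
        HasEFOfSize (corPolytopeGraph (⊤ : SimpleGraph (Fin n)) + convexHull ℝ (Set.range q)) r →
          ∃ q' : Fin 2 → (Fin m × Fin m → ℝ),
            HasEFOfSize (corPolytopeGraph (⊤ : SimpleGraph (Fin m)) + convexHull ℝ (Set.range q')) r := by
  intro n m β ρ hρ K q r hJ hEF
  obtain ⟨B, hB⟩ := exists_blockDir β
  -- step 0: the contraction face
  obtain ⟨j₀, -, hmax⟩ :=
    Finset.exists_max_image Finset.univ (fun j => B ⬝ᵥ q j) Finset.univ_nonempty
  have hQ : ∀ y ∈ convexHull ℝ (Set.range q), B ⬝ᵥ y ≤ B ⬝ᵥ q j₀ :=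
    dot_le_of_mem_convexHull _ _ _ (by rintro _ ⟨j, rfl⟩; exact hmax j (Finset.mem_univ _))
  have h0 := hEF.face_add_face₁ B 0 (B ⬝ᵥ q j₀) (blockDir_valid β hB) hQ
  have hQeq : convexHull ℝ (Set.range q) ∩ {y | B ⬝ᵥ y = B ⬝ᵥ q j₀} =
      convexHull ℝ (q '' ((Finset.univ.filter fun j => B ⬝ᵥ q j = B ⬝ᵥ q j₀ : Finset (Fin (K + 1))) :
        Set (Fin (K + 1)))) := by
    rw [convexHull_range_inter_eq q B _ (fun j => hmax j (Finset.mem_univ _))]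
    congr 1
    ext y
    constructor
    · rintro ⟨⟨j, hj⟩, rfl⟩
      exact ⟨j, Finset.mem_coe.2 (Finset.mem_filter.2 ⟨Finset.mem_univ _, hj⟩), rfl⟩
    · rintro ⟨j, hj, rfl⟩
      exact ⟨⟨j, (Finset.mem_filter.1 (Finset.mem_coe.1 hj)).2⟩, rfl⟩
  rw [hQeq] at h0
  have hne₁ : (Finset.univ.filter fun j => B ⬝ᵥ q j = B ⬝ᵥ q j₀ : Finset (Fin (K + 1))).Nonempty :=
    ⟨j₀, Finset.mem_filter.2 ⟨Finset.mem_univ _, rfl⟩⟩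
  obtain ⟨J', -, hne', hall, hEF'⟩ := blockRead_iterate β hB q r _ _ le_rfl hne₁ h0
  -- all surviving differences are multiples of `J`: the passenger is a segment
  obtain ⟨j₁, hj₁⟩ := hne'
  have hαex : ∀ j, ∃ α : ℝ, j ∈ J' → q j - q j₁ = α • (fun _ : Fin n × Fin n => (1 : ℝ)) := by
    intro j
    by_cases hj : j ∈ J'
    · obtain ⟨α, hα⟩ := hJ j j₁ (blockConstSym_of_mem_span β (hall j hj j₁ hj₁))
      exact ⟨α, fun _ => hα⟩
    · exact ⟨0, fun h => (hj h).elim⟩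
  choose α hα using hαex
  have hq : ∀ j ∈ J', q j = q j₁ + α j • (fun _ : Fin n × Fin n => (1 : ℝ)) := fun j hj => by
    rw [← hα j hj, add_sub_cancel]
  obtain ⟨a, -, b, -, hpair⟩ :=
    convexHull_collinear_pair q (fun _ : Fin n × Fin n => (1 : ℝ)) J' ⟨j₁, hj₁⟩ α (q j₁) hq
  rw [hpair] at hEF'
  -- read by representatives
  have h2 := hEF'.image_linearMap (LinearMap.funLeft ℝ ℝ (fun ij : Fin m × Fin m => (ρ ij.1, ρ ij.2)))
  rw [Set.image_add, funLeft_image_cor_blockFace β hB hρ, LinearMap.image_convexHull] at h2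
  refine ⟨fun i => if i = 0 then LinearMap.funLeft ℝ ℝ (fun ij : Fin m × Fin m => (ρ ij.1, ρ ij.2)) (q a)
    else LinearMap.funLeft ℝ ℝ (fun ij : Fin m × Fin m => (ρ ij.1, ρ ij.2)) (q b), ?_⟩
  convert h2 using 3
  ext y
  constructor
  · rintro ⟨i, rfl⟩
    by_cases hi : i = 0
    · exact ⟨q a, Or.inl rfl, by simp [hi]⟩
    · exact ⟨q b, Or.inr rfl, by simp [hi]⟩
  · rintro ⟨x, hx, rfl⟩
    rcases hx with rfl | hx
    · exact ⟨0, by simp⟩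
    · rw [Set.mem_singleton_iff] at hx
      subst hx
      exact ⟨1, by simp⟩

end LocatedFaceExposure

end Summit.ValiantsHypothesis.ValiantsHypothesis.Theorems.FifoMatching

end
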